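import Mathlib
import Literature.Analysis.FluidPDE.SelfSimilar
import Literature.Analysis.FluidPDE.NSBoundedMildAnalytic
import Summits.NavierStokesRegularity.NavierStokesRegularity.Theorems.TypeILiouvilleTypeIliouvilleLOseenGauge
import Summits.NavierStokesRegularity.NavierStokesRegularity.Theorems.UnthreadedDoorCellFluxDefs
import HarnessLib

/-!
# Route `UnthreadedDoor`, crux `PoloidalLiouville` (stmt-NavierStokesRegularity-1222), WALL W1 — stub HH-0⁺
# `CellFlux.NSSpaceTimeAnalyticityModGauge` (lines «cell-flux» / «indicatrix-bound» of ns-idea-14; input I2″ of «silent-shells», ns-idea-15):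
# space–time analyticity of smooth bounded ancient mild solutions MODULO THE GALILEAN GAUGE

The registered stub HH-0⁺ v1.1 `stub_nsSpaceTimeAnalyticityModGauge : NSSpaceTimeAnalyticityModGauge`
(`Cruxes/PoloidalLiouville/CellFluxSketch.lean` l.670, `…/IndicatrixSketch.lean` l.508; Theorems-side twin
`Theorems/UnthreadedDoorCellFluxDefs.lean` l.111, p692073), proved with its binders VERBATIM (`nsSpaceTimeAnalyticityModGauge`):
every bounded ancient mild solution (duality form, `ν = 1`) with a.e.-strongly-measurable slices, smooth on the open past slab,
is EVERYWHERE of the form `v t x = w t (x − A t) + c t` with `A` continuous and `uncurry w` jointly real-analytic on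
`(−∞,0) × ℝ³`.  It is the in-tree corollary announced in the stub's docstring, followed literally:

* the **Oseen gauge theorem** `Theorems.oseen_gauge_of_aestronglyMeasurable` (crux `TypeIliouvilleL`): the representation
  a.e. per slice, `w` jointly measurable, continuous and uniformly bounded on the slab, pointwise Oseen-mild for all
  `s < t < 0`, `A` continuous;
* **local analyticity of Oseen's scheme** — Lemarié-Rieusset 2016, Thm. 9.12, the tree's PROVED local form
  `Literature.Analysis.FluidPDE.lemarieRieusset2016_local_analyticity_holds`: the Oseen fixed point from a bounded datum is
  JOINTLY real-analytic on its window `(s, s + ε/M²) × ℝ³`;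
* **uniqueness of bounded Oseen-mild solutions** `oseenMild_bounded_unique`, window by window: restarted at
  `s₁ = t − ½·ε/M²`, the local analytic solution agrees with `w` a.e. on every slice of the common window, hence everywhere
  on it (both are continuous in `x`), so `uncurry w` coincides with a jointly analytic map on an open space–time
  neighbourhood of `(t, x)` (`oseenGauge_analyticOnNhd_uncurry`; the argument of
  `IsTypeIAncientMild.analyticOnNhd_slice_univ`, `BarkerPrange2020VorticityAlignmentTypeIHolds.lean`, with a uniform bound and
  kept joint in `(t, x)`);
* both sides of the a.e. Galilean representation are continuous in `x` (the slice `v t` by the smoothness binder), hence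
  equal everywhere (`Continuous.ae_eq_iff_eq`).

By-products (namespace `…SilentShells`, for the «silent-shells» record where I1 `SliceAnalytic` is FALSE AS TYPED,
`SilentShells.sliceAnalytic_false_as_typed`, and I1′ `SliceAnalytic'` = HH-0 `NetFlux.nsSpatialAnalyticity` by name):
`SilentShells.exists_analyticOnNhd_ae_eq_slice` — the binder-free statement the a.e.-blind class actually supports: **every
slice of a bounded ancient mild solution with a.e.-measurable slices is a.e. EQUAL to a real-analytic field** — and
`SilentShells.analyticOnNhd_slice_of_continuous` (a continuous slice is real-analytic).

WHAT THIS IS NOT: no new NS estimate; the naive (gauge-free) space–time analyticity `NSSpaceTimeAnalyticityNaive` stays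
false as recorded; `PoloidalLiouville` (1222), Σ-5a `UnthreadedGaugeRigidity`, I2″ and W1 stay OPEN; NS regularity is NOT
proved.  `--supports stmt-NavierStokesRegularity-1222 --as helper`; 0 kit.  [folklore]
-/

-- the summit and its single problem share the name (D-0017 nested layout)
set_option linter.dupNamespace false

noncomputable section

open Set Function Filter Topology Metric MeasureTheory
open scoped Topology ENNReal
open Literature.Analysis Literature.Analysis.FluidPDE

namespace Summit.NavierStokesRegularity.NavierStokesRegularity.Theorems.PoloidalLiouville.CellFlux

open Summit.NavierStokesRegularity.NavierStokesRegularity.Theorems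

/-! ### The Oseen-gauge field is jointly real-analytic -/

/-- **An Oseen-gauge field is jointly real-analytic on the open past slab.**  If `v : ℝ → ℝ³ → ℝ³` is jointly
measurable, continuous on `(−∞,0) × ℝ³`, uniformly bounded there, and solves the Oseen integral equation
`v t x = e^{(t−s)Δ}(v s)(x) − B¹_s(v,v)(t,x)` pointwise for all `s < t < 0` (the output of
`oseen_gauge_of_aestronglyMeasurable`), then `uncurry v` is real-analytic on `Iio 0 ×ˢ univ`: near `(t, x)` it coincides
with the jointly analytic local Oseen solution restarted at `s₁ = t − ½·ε/M²`
(`lemarieRieusset2016_local_analyticity_holds` + `oseenMild_bounded_unique` + continuity of the slices). [folklore] -/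
theorem oseenGauge_analyticOnNhd_uncurry
    {v : ℝ → EuclideanSpace ℝ (Fin 3) → EuclideanSpace ℝ (Fin 3)}
    (hvm : Measurable (uncurry v)) (hvc : ContinuousOn (uncurry v) (Iio 0 ×ˢ univ))
    {K : ℝ} (hvK : ∀ t < 0, ∀ x, ‖v t x‖ ≤ K)
    (hmild : ∀ s t : ℝ, s < t → t < 0 → ∀ x,
      v t x = UnboundedOperators.heatExtension (v s) (t - s) x - oseenDuhamel 1 s v v t x) :
    AnalyticOnNhd ℝ (uncurry v) (Iio (0 : ℝ) ×ˢ (univ : Set (EuclideanSpace ℝ (Fin 3)))) := by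
  obtain ⟨ε, hε, C₀, hC₀, hloc⟩ := lemarieRieusset2016_local_analyticity_holds
  -- slices of `v` are continuous
  have hslice : ∀ τ < 0, Continuous (v τ) := fun τ hτ =>
    hvc.comp_continuous (Continuous.prodMk_right τ) fun x => ⟨hτ, mem_univ _⟩
  -- a positive uniform bound
  set Mb : ℝ := max K 0 + 1 with hMb
  have hMb0 : 0 < Mb := by rw [hMb]; linarith [le_max_right K 0]
  have hnormle : ∀ τ < 0, ∀ x, ‖v τ x‖ ≤ Mb := fun τ hτ x =>
    (hvK τ hτ x).trans ((le_max_left K 0).trans (by rw [hMb]; linarith))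
  have hlen : 0 < ε * 1 / Mb ^ 2 := by positivity
  rintro ⟨t, x⟩ ⟨ht, -⟩
  change t < 0 at ht
  -- the initial time of the analytic window
  set s₁ : ℝ := t - (ε * 1 / Mb ^ 2) / 2 with hs₁
  have hs₁t : s₁ < t := by rw [hs₁]; linarith
  have hs₁0 : s₁ < 0 := by linarith
  have ha_meas : AEStronglyMeasurable (v s₁) volume := (hslice s₁ hs₁0).aestronglyMeasurable
  have ha_bd : eLpNorm (v s₁) ∞ volume ≤ ENNReal.ofReal Mb := by
    rw [eLpNorm_exponent_top]
    exact eLpNormEssSup_le_of_ae_bound (Eventually.of_forall fun y => hnormle s₁ hs₁0 y)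
  obtain ⟨vl, hvl_an, hvl_eq, hvl_bd⟩ := hloc one_pos s₁ hMb0 ha_meas ha_bd
  -- the common window `(s₁, T₂)`, `T₂ = min (s₁ + ε/Mb²) (t/2) ∋ t`
  set T₂ : ℝ := min (s₁ + ε * 1 / Mb ^ 2) (t / 2) with hT₂
  have htT₂ : t < T₂ := lt_min (by rw [hs₁]; linarith) (by linarith)
  have hT₂0 : T₂ < 0 := (min_le_right _ _).trans_lt (by linarith)
  have hT₂h : T₂ ≤ s₁ + ε * 1 / Mb ^ 2 := min_le_left _ _
  -- uniqueness of bounded Oseen-mild solutions on the window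
  set M' : ℝ := max Mb (C₀ * Mb) with hM'
  have hM'0 : 0 ≤ M' := hMb0.le.trans (le_max_left _ _)
  have hum : AEStronglyMeasurable (uncurry v) (volume.restrict (Ioo s₁ T₂ ×ˢ univ)) :=
    hvm.aestronglyMeasurable
  have hvlm : AEStronglyMeasurable (uncurry vl) (volume.restrict (Ioo s₁ T₂ ×ˢ univ)) :=
    (hvl_an.continuousOn.mono (prod_mono (Ioo_subset_Ioo_right hT₂h) Subset.rfl)).aestronglyMeasurable
      (measurableSet_Ioo.prod MeasurableSet.univ)
  have huM : ∀ τ ∈ Ioo s₁ T₂, ∀ y, ‖v τ y‖ ≤ M' := fun τ hτ y =>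
    (hnormle τ (hτ.2.trans hT₂0) y).trans (le_max_left _ _)
  have hvM : ∀ τ ∈ Ioo s₁ T₂, ∀ y, ‖vl τ y‖ ≤ M' := fun τ hτ y =>
    (hvl_bd τ ⟨hτ.1, hτ.2.trans_le hT₂h⟩ y).trans (le_max_right _ _)
  have hu : ∀ τ ∈ Ioo s₁ T₂, v τ =ᵐ[volume] fun y =>
      UnboundedOperators.heatExtension (v s₁) (1 * (τ - s₁)) y - oseenDuhamel 1 s₁ v v τ y :=
    fun τ hτ => Eventually.of_forall fun y => by
      rw [one_mul]
      exact hmild s₁ τ hτ.1 (hτ.2.trans hT₂0) y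
  have hv : ∀ τ ∈ Ioo s₁ T₂, vl τ =ᵐ[volume] fun y =>
      UnboundedOperators.heatExtension (v s₁) (1 * (τ - s₁)) y - oseenDuhamel 1 s₁ vl vl τ y :=
    fun τ hτ => Eventually.of_forall fun y => hvl_eq τ ⟨hτ.1, hτ.2.trans_le hT₂h⟩ y
  have heq := oseenMild_bounded_unique
    (U := fun τ y => UnboundedOperators.heatExtension (v s₁) (1 * (τ - s₁)) y)
    one_pos hM'0 hum hvlm huM hvM hu hv
  -- `v = vl` everywhere on the window (both slices are continuous)
  have hvvl : ∀ τ ∈ Ioo s₁ T₂, v τ = vl τ := by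
    intro τ hτ
    have hτwin : τ ∈ Ioo s₁ (s₁ + ε * 1 / Mb ^ 2) := ⟨hτ.1, hτ.2.trans_le hT₂h⟩
    have hvlτ : AnalyticOnNhd ℝ (vl τ) univ := analyticOnNhd_slice hvl_an hτwin
    exact (Continuous.ae_eq_iff_eq volume (hslice τ (hτ.2.trans hT₂0))
      (continuousOn_univ.1 hvlτ.continuousOn)).1 (heq τ hτ)
  -- hence `uncurry v = uncurry vl` near `(t, x)`, and `uncurry vl` is analytic there
  have hopen : IsOpen (Ioo s₁ T₂ ×ˢ (univ : Set (EuclideanSpace ℝ (Fin 3)))) := isOpen_Ioo.prod isOpen_univ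
  have hmem : ((t, x) : ℝ × EuclideanSpace ℝ (Fin 3)) ∈ Ioo s₁ T₂ ×ˢ (univ : Set (EuclideanSpace ℝ (Fin 3))) :=
    ⟨⟨hs₁t, htT₂⟩, mem_univ _⟩
  have hev : uncurry vl =ᶠ[𝓝 ((t, x) : ℝ × EuclideanSpace ℝ (Fin 3))] uncurry v := by
    filter_upwards [hopen.mem_nhds hmem] with p hp
    obtain ⟨τ, y⟩ := p
    simp only [uncurry_apply_pair]
    rw [hvvl τ hp.1]
  have han : AnalyticAt ℝ (uncurry vl) ((t, x) : ℝ × EuclideanSpace ℝ (Fin 3)) :=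
    hvl_an _ ⟨⟨hs₁t, htT₂.trans_le hT₂h⟩, mem_univ _⟩
  exact han.congr hev

/-- **Slices of an Oseen-gauge field are real-analytic on `ℝ³`** (the slice form of
`oseenGauge_analyticOnNhd_uncurry`). [folklore] -/
theorem oseenGauge_analyticOnNhd_slice
    {v : ℝ → EuclideanSpace ℝ (Fin 3) → EuclideanSpace ℝ (Fin 3)}
    (hvm : Measurable (uncurry v)) (hvc : ContinuousOn (uncurry v) (Iio 0 ×ˢ univ))
    {K : ℝ} (hvK : ∀ t < 0, ∀ x, ‖v t x‖ ≤ K)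
    (hmild : ∀ s t : ℝ, s < t → t < 0 → ∀ x,
      v t x = UnboundedOperators.heatExtension (v s) (t - s) x - oseenDuhamel 1 s v v t x)
    {t : ℝ} (ht : t < 0) :
    AnalyticOnNhd ℝ (v t) univ :=
  analyticOnNhd_slice (oseenGauge_analyticOnNhd_uncurry hvm hvc hvK hmild) (mem_Iio.2 ht)

/-! ### HH-0⁺ by name -/

/-- **HH-0⁺ v1.1 `CellFlux.NSSpaceTimeAnalyticityModGauge` (`Theorems/UnthreadedDoorCellFluxDefs.lean` l.111; cell-flux sketch
l.670 / indicatrix sketch l.508 `stub_nsSpaceTimeAnalyticityModGauge`), binders VERBATIM.**  A bounded ancient mild solution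
(duality form, `ν = 1`) with a.e.-strongly-measurable slices, smooth on `(−∞,0) × ℝ³`, is EVERYWHERE
`v t x = w t (x − A t) + c t` with `A` continuous and `uncurry w` jointly real-analytic on `(−∞,0) × ℝ³`: the Oseen gauge
theorem supplies `(A, c, w)` with the representation a.e. per slice; `uncurry w` is analytic by
`oseenGauge_analyticOnNhd_uncurry`; both sides are continuous in `x`, so the representation holds everywhere
(Lemarié-Rieusset 2016 Thm. 9.12 «analytical in the time and space variables», here modulo the Galilean gauge of the
duality class). [folklore] -/
theorem nsSpaceTimeAnalyticityModGauge : NSSpaceTimeAnalyticityModGauge := by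
  intro u hu hmeas hsmooth
  obtain ⟨w, A, c, hwm, hwc, ⟨K, hK⟩, -, hwmild, hA, hrep⟩ :=
    Theorems.oseen_gauge_of_aestronglyMeasurable u hu hmeas
  refine ⟨A, c, w, hA, oseenGauge_analyticOnNhd_uncurry hwm hwc hK hwmild, fun t ht => ?_⟩
  have hslice : Continuous (w t) :=
    hwc.comp_continuous (Continuous.prodMk_right t) fun x => ⟨ht, mem_univ _⟩
  have hut : Continuous (u t) :=
    hsmooth.continuousOn.comp_continuous (Continuous.prodMk_right t) fun x => ⟨ht, mem_univ _⟩
  have hrhs : Continuous fun x : EuclideanSpace ℝ (Fin 3) => w t (x - A t) + c t :=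
    (hslice.comp (continuous_id.sub continuous_const)).add continuous_const
  have heq : u t = fun x => w t (x - A t) + c t :=
    (Continuous.ae_eq_iff_eq volume hut hrhs).1 (hrep t ht)
  intro x
  rw [heq]

end Summit.NavierStokesRegularity.NavierStokesRegularity.Theorems.PoloidalLiouville.CellFlux

/-! ### By-products for «silent-shells» (ns-idea-15): the binder-free true form of I1 -/

namespace Summit.NavierStokesRegularity.NavierStokesRegularity.Theorems.PoloidalLiouville.SilentShells

open Summit.NavierStokesRegularity.NavierStokesRegularity.Theorems
open Summit.NavierStokesRegularity.NavierStokesRegularity.Theorems.PoloidalLiouville.CellFlux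
  (oseenGauge_analyticOnNhd_slice)

/-- **Every slice of a bounded ancient mild solution is a.e. equal to a real-analytic field** — binder-free and TRUE,
the statement the a.e.-blind duality class actually supports behind the sketch's I1 `SliceAnalytic` (which is false as
typed, `sliceAnalytic_false_as_typed`): the slice `u t` is a.e. the Galilean image `x ↦ v (t, x − A t) + c t` of the
Oseen-gauge slice, which is analytic (`CellFlux.oseenGauge_analyticOnNhd_slice`), and translations / added constants
preserve analyticity. [folklore] -/
theorem exists_analyticOnNhd_ae_eq_slice
    (u : ℝ → EuclideanSpace ℝ (Fin 3) → EuclideanSpace ℝ (Fin 3))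
    (hu : IsBoundedAncientMildSolution 1 u) (hmeas : ∀ t < 0, AEStronglyMeasurable (u t) volume)
    {t : ℝ} (ht : t < 0) :
    ∃ g : EuclideanSpace ℝ (Fin 3) → EuclideanSpace ℝ (Fin 3), AnalyticOnNhd ℝ g univ ∧ u t =ᵐ[volume] g := by
  obtain ⟨v, A, c, hvm, hvc, ⟨K, hvK⟩, -, hmild, -, hrep⟩ := Theorems.oseen_gauge_of_aestronglyMeasurable u hu hmeas
  have hvt : AnalyticOnNhd ℝ (v t) univ := oseenGauge_analyticOnNhd_slice hvm hvc hvK hmild ht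
  refine ⟨fun x => v t (x - A t) + c t, ?_, hrep t ht⟩
  have htr : AnalyticOnNhd ℝ (fun x : EuclideanSpace ℝ (Fin 3) => x - A t) univ :=
    analyticOnNhd_id.sub analyticOnNhd_const
  exact (hvt.comp htr (mapsTo_univ _ _)).add analyticOnNhd_const

/-- **A CONTINUOUS slice of a bounded ancient mild solution is real-analytic** (binder-minimal pointwise form; I1′ =
HH-0 `NetFlux.nsSpatialAnalyticity` uses its `ContDiffOn` binder only through this): the slice is a.e. equal to an
analytic field (`exists_analyticOnNhd_ae_eq_slice`) and two continuous fields that agree a.e. agree everywhere. [folklore] -/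
theorem analyticOnNhd_slice_of_continuous
    (u : ℝ → EuclideanSpace ℝ (Fin 3) → EuclideanSpace ℝ (Fin 3))
    (hu : IsBoundedAncientMildSolution 1 u) (hmeas : ∀ t < 0, AEStronglyMeasurable (u t) volume)
    {t : ℝ} (ht : t < 0) (hcont : Continuous (u t)) :
    AnalyticOnNhd ℝ (u t) univ := by
  obtain ⟨g, hg, hug⟩ := exists_analyticOnNhd_ae_eq_slice u hu hmeas ht
  have hutg : u t = g :=
    (Continuous.ae_eq_iff_eq volume hcont (continuousOn_univ.1 hg.continuousOn)).1 hug
  rw [hutg]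
  exact hg

end Summit.NavierStokesRegularity.NavierStokesRegularity.Theorems.PoloidalLiouville.SilentShells
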